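import Literature.AnabelianGeometry.EtaleTheta.ArithThetaTowerCThetaUnits
import Literature.AnabelianGeometry.EtaleTheta.ArithThetaTowerCor38ii
import Literature.AlgebraicGeometry.Frobenioids.PadicFrobenioidUnitGroups
import HarnessLib

/-!
# [IUTchI] Ex. 3.2 (iv)/(v) at the ARITHMETIC theta tower over `𝒟_v̲ = CosetCat Π_v̲`: GENUINE CONSTANTS OVER A BASE
# FUNCTOR — the morphism of model data `(Φ_{𝒞⊢_v}, B_{𝒞⊢_v}) → (Φ, B)|_G` and the faithful constants functor
# `𝒞⊢_v → ℱ̲_v` over `G : 𝒟⊢_v̲ ⥤ 𝒟_v̲` (GAP A item GA-15 = C0, file 1/2)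

S. Mochizuki, *Inter-universal Teichmüller Theory I* [Mochizuki2012], Ex. 3.2 (iv) p. 71 («`Φ_{𝒞⊢_v} := ℕ·log_Φ(q̲_v)|_{𝒟⊢_v}`
… a `p_v`-adic Frobenioid `𝒞⊢_v (⊆ 𝒞_v ⊆ ℱ̲_v)` whose base category is `𝒟⊢_v`»), (v) p. 72 («`𝒟^Θ_v ⊆ (𝒟_v)_{Ÿ_v}` … the
products in `𝒟_v` of `Ÿ_v` with objects of `𝒟⊢_v` … `𝒞^Θ_v ⊆ ℱ÷_v`») [claim: Mochizuki2012, status: disputed] (D-0012 claim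
key; CONSTRUCTIONS over our typed objects, nothing of the series asserted); *The geometry of Frobenioids I* [MochizukiFrdI2008]
Thm. 5.2 (i) p. 100 / Thm. 6.2 (i) p. 111 (a morphism of model data over a base functor induces a functor of model
Frobenioids; the tree's `ModelFrobenioid.DataHomOver`/`.functor`), Cor. 5.4 p. 104 (faithfulness criterion, the tree's
`DataHomOver.functor_faithful`); *… Frobenioids II* [MochizukiFrdII2008] Ex. 1.1 (ii) p. 8 (the monogenic datum
`Φ^c = ℕ·ord(c)`, `B^c = K^× ×_{Φ₀^gp} (Φ^c)^gp`, the tree's `PadicFrd.Datum.monogenic`); *The étale theta function …*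
[MochizukiEtTh2009] Def. 3.6 (ii) p. 77 (`B = B₀^Λ|_D ×_{(Φ^{ℝ-log})^gp} Φ^gp`).

GAP A of record G-L5-EX32I-1 (abc-iut cell), item GA-15 = the COUNT-NEUTRAL C0 non-vacuity witness (RULINGS #333 (b)):
`plan/L5/GAP-A-SIGNATURES.md` v1 e3ccddf9b87597cf §0/§5 — every decl over the BINDERS `(C : TemperedFrobenioid T' T.Dv VD)
(hC : ArithThetaTower.CarrierSpec d T C)` (GA-04's S0 decoupling spec, `ArithThetaTowerFrobenioid.lean`), never over the term.

WHAT IS HERE (file 1/2; file 2/2 `ArithThetaTowerOneDatum.lean` builds the `𝒞^Θ_v ⊆ ℱ÷_v` slot and assembles the witness).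
For ANY functor `G : 𝒟⊢_v̲ ⥤ 𝒟_v̲` with a transformation `τ : G ⟶ T.incl` — the two instances of record being `G = T.incl`,
`τ = 𝟙` (print's `𝒟⊢_v ⊆ 𝒟_v`, GA-13's `cdashToC`) and `G = (Ÿ_v × −) = T.prodFunctor ⋙ Over.forget`, `τ = pr₂` (print's
`𝒟^Θ_v ⊆ (𝒟_v)_{Ÿ_v} → 𝒟_v`, file 2/2) —:
* `CarrierSpec.ofLattice_injective` (GA-06's lattice read `Φ₀ → Φ` is injective, by GA-14's
  `RealifiedDivisorMonoids.toR_injective_weak`; its naturality `pull_ofLattice` and `constRatFn_natural` are GA-06's,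
  `ArithThetaTowerCThetaUnits.lean`, cited BY NAME), `CarrierSpec.constDiv hC A : ord(𝒪^▷_{Ω^{aug A}}) → Φ(A)` (the divisor
  of a genuine constant, `= ofLattice ∘ ι` from `hC.consts`) + `pull_constDiv` + `constDiv_injective`;
* `baseHomOver G τ V : aug(G V) ⟶ V` and the field transports `fieldTransport G τ V : Ω^V → Ω^{aug(G V)}` (natural,
  valuative, carrying `q̲` to `q̲`);
* the components `constη` (`n·log_Φ(q̲) ↦ n·log_Φ(q̲)|_{G V}`, via `powersLift` on the free monoid `ℕ·log q̲`) and `constβ`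
  (`(x, γ) ↦` the constant rational function `x|_{Ω^{aug(G V)}}` at `G V`), their naturality and INJECTIVITY, the decoding
  lemma `divUnits_eq_of_mem_BSub` (`B_{𝒞⊢} = 𝒪^× · q̲^ℤ`: the valuation class of `x` is the exponent of `γ`);
* **`constDataHomOver G τ hC hq : ModelFrobenioid.DataHomOver G (d.dashDatum hq).divB C.divBNatTrans`**,
  **`constFunctorOver G τ hC hq : d.Cdash hq ⥤ C.category`**, `constFunctorOver_comp_base` (over `G` ON THE NOSE) and
  **`constFunctorOver_faithful`** for `G` faithful — NON-VACUOUSLY: defined on all of `𝒞⊢_v̲`, faithful by proof for every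
  carrier satisfying the spec, honest at C1 because `B(A) ⊇ (Ω^{aug A})^×` with genuine valuations (`hC.consts`; crit-A F2:
  constants via `T.proj`, NOT via `rebase`).
Relation to GA-13 (`ArithThetaTowerCdashFaithful.lean`): GA-13's `cdashToC` is the HULL-valued instance at `G = incl`
(target `C.hullCategory`, as the slot field `CdashToC` demands); this file's functor is `C.category`-valued (what the
`𝒞^Θ_v ⊆ ℱ÷_v` slot needs before `toBirat`) and generic in `G`; neither restates the other.

carrier: genuine-by-[EtTh]-recipe on the T-lattice (Ÿ_T, Ÿ_T × V, X̲̲_v̲ × V) + constants everywhere; off-lattice Φ via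
`rebase`/pullback; [EtTh] Def 3.3 Φ at general U and print's Ÿ̈/μ_N Kummer levels = FOUNDATIONS 13/14, not claimed (#322
(c3′); this file defines no carrier, it reads the one `hC` specifies).  HONEST FRAMING: functors and theorems over a
`Prop`-valued spec at OUR typed objects; TYPED ≠ INHABITED (the term is GA-12's) ≠ proved-in-print; an UNDISPUTED construction
around [IUTchIII] Cor. 3.12, which stays OPEN by charter (D-0045) — no side taken on it or on any author; nothing here asserts
the abc conjecture proved or refuted; count-neutral (no token moves on C0).  No instance, no notation, no `sorry`.
-/

noncomputable section

namespace Literature.AnabelianGeometry.EtaleTheta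

namespace ArithThetaTower

open CategoryTheory Opposite Function Literature.AlgebraicGeometry.Frobenioids Literature.AnabelianGeometry.SemiGraphs
  Literature.IUT.HodgeTheaters Literature.AlgebraicGeometry.Frobenioids.PadicFrd

variable {p : ℕ} [Fact p.Prime] {d : GaloisValDatum.{0} p} {P : Type} [Group P] [TopologicalSpace P]
  {T : BadLocalGroupDatum d.Gal P}
  {T' : RealifiedDivisorMonoids (D₀ := T.Dv) treeMonoidVocabWeak.{0}} {VD : FrdICatStub.{0, 0, 0} T.Dv}
  {C : TemperedFrobenioid T' T.Dv VD}

namespace CarrierSpec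

/-! ## The divisor of a genuine constant read in `Φ`, natural along `𝒟_v̲ → 𝒟⊢_v̲` (`T.proj`), injective -/

/-- **The divisor of a genuine constant read in `Φ`**: `ord(𝒪^▷_{Ω^{aug A}}) → Φ(A)`, `a ↦` the lattice read of `ι(a)`
— the effective divisor of a constant of valuation class `a` at the object `A`. [cite: MochizukiEtTh2009, Def 3.6 p.77] -/
def constDiv (hC : CarrierSpec d T C) (A : T.Dv) :
    PadicFrd.OrdInt (d.fieldFunctor.obj (T.proj.obj A)).K →* C.Φ.carrier (op A) :=
  (hC.ofLattice A).comp (hC.constDivIncl (op A))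

/-- `constDiv` unfolded. [cite: MochizukiEtTh2009, Def 3.6 p.77] -/
theorem constDiv_apply (hC : CarrierSpec d T C) (A : T.Dv) (a : PadicFrd.OrdInt (d.fieldFunctor.obj (T.proj.obj A)).K) :
    hC.constDiv A a = hC.ofLattice A (hC.constDivIncl (op A) a) := rfl

/-- **`constDiv` is natural** along `T.proj`: pulling back the divisor of a constant along `g : A → A'` gives the
divisor of the same constant read in the bigger field `Ω^{aug A} ⊇ Ω^{aug A'}` (`ι` natural, `hC.consts`).
[cite: MochizukiEtTh2009, Def 3.6 p.77] -/
theorem pull_constDiv (hC : CarrierSpec d T C) {A A' : T.Dv} (g : A ⟶ A')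
    (a : PadicFrd.OrdInt (d.fieldFunctor.obj (T.proj.obj A')).K) :
    C.Φ.pull g.op (hC.constDiv A' a) =
      hC.constDiv A (PadicFrd.ordIntMapOfHom (d.fieldFunctor.map (T.proj.map g)).alg
        (d.fieldFunctor.map (T.proj.map g)).isValHom a) := by
  rw [constDiv_apply, constDiv_apply, pull_ofLattice]
  exact congrArg (hC.ofLattice A) (hC.consts_spec.2.2.2.1 g.op a)

/-- The lattice read `Φ₀(A) → Φ(A)` is injective (`Φ₀ → Φ₀^ℝ` is injective over the weak vocabulary, GA-14's
`RealifiedDivisorMonoids.toR_injective_weak`; transport along `Y_A = A`). [cite: MochizukiEtTh2009, Def 3.6 p.77] -/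
theorem ofLattice_injective (hC : CarrierSpec d T C) (A : T.Dv) : Injective (hC.ofLattice A) := fun a b h => by
  have h' := congrArg (fun x : C.Φ.carrier (op A) => (T'.ΦR.map (hC.baseIso A).inv.op).hom (x : T'.ΦR.obj _)) h
  simp only [coe_ofLattice] at h'
  rw [← MonoidHom.comp_apply, ← CommMonCat.hom_comp, ← Functor.map_comp, ← op_comp, Iso.inv_hom_id, op_id,
    CategoryTheory.Functor.map_id, CommMonCat.hom_id, MonoidHom.id_apply, ← MonoidHom.comp_apply,
    ← CommMonCat.hom_comp, ← Functor.map_comp, ← op_comp, Iso.inv_hom_id, op_id, CategoryTheory.Functor.map_id,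
    CommMonCat.hom_id, MonoidHom.id_apply] at h'
  exact RealifiedDivisorMonoids.toR_injective_weak T' (op A) h'

/-- `constDiv` is injective (`ι` injective, `hC.consts`; the lattice read injective). [cite: MochizukiEtTh2009, Def 3.6 p.77] -/
theorem constDiv_injective (hC : CarrierSpec d T C) (A : T.Dv) : Injective (hC.constDiv A) :=
  (hC.ofLattice_injective A).comp (hC.constDivIncl_injective (op A))

end CarrierSpec

/-! ## A monoid free on one generator: homomorphisms out of `ℕ·x` -/

/-- The homomorphism `ℕ·x → N`, `x^n ↦ y^n`, out of the powers of a NON-TORSION element `x` (the exponent read by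
Mathlib's `Submonoid.powLogEquiv`). [folklore] -/
def powersLift {M N : Type} [CommMonoid M] [CommMonoid N] {x : M} (h : Injective fun n : ℕ => x ^ n) (y : N) :
    ↥(Submonoid.powers x) →* N := by
  classical
  exact (powersHom N y).comp (Submonoid.powLogEquiv h).symm.toMonoidHom

/-- `powersLift h y (x^n) = y^n`. [folklore] -/
private theorem powersLift_pow {M N : Type} [CommMonoid M] [CommMonoid N] {x : M} (h : Injective fun n : ℕ => x ^ n) (y : N)
    (n : ℕ) : powersLift h y ⟨x ^ n, n, rfl⟩ = y ^ n := by
  classical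
  have e : (⟨x ^ n, n, rfl⟩ : ↥(Submonoid.powers x)) = Submonoid.pow x n := rfl
  rw [powersLift, e, MonoidHom.comp_apply, MulEquiv.coe_toMonoidHom, Submonoid.powLogEquiv_symm_apply,
    Submonoid.log_pow_eq_self h, powersHom_apply, toAdd_ofAdd]

/-- Two homomorphisms out of `ℕ·x` agreeing on the powers of `x` are equal. [folklore] -/
private theorem powers_hom_ext {M N : Type} [CommMonoid M] [MulOneClass N] {x : M} {f g : ↥(Submonoid.powers x) →* N}
    (h : ∀ n : ℕ, f ⟨x ^ n, n, rfl⟩ = g ⟨x ^ n, n, rfl⟩) : f = g :=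
  MonoidHom.ext fun ⟨_, n, hn⟩ => by subst hn; exact h n

/-! ## The base morphisms `aug(G V) → V` of `𝒟⊢_v̲` and the field transports `Ω^V → Ω^{aug (G V)}` -/

section OverG

variable (G : T.Ddash ⥤ T.Dv) (τ : G ⟶ T.incl)

/-- For a functor `G : 𝒟⊢_v̲ ⥤ 𝒟_v̲` equipped with `τ : G ⟶ incl` (the two cases of record: `G = incl`, `τ = 𝟙`, for
`𝒞⊢_v → 𝒞_v` over `𝒟⊢_v ⊆ 𝒟_v`; `G = (Ÿ_v × −)`, `τ = pr₂`, for `𝒞^Θ_v` over `𝒟^Θ_v → 𝒟_v`): the morphism `aug(G V) → V` of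
`𝒟⊢_v̲` — `aug(τ_V)` followed by the counit `aug(aug⁻¹ V) → V` of `aug ⊣ aug⁻¹` (`T.adj`).
[cite: Mochizuki2012, I Ex 3.2 (iv)(v) pp.71-72] -/
def baseHomOver (V : T.Ddash) : T.proj.obj (G.obj V) ⟶ V :=
  T.proj.map (τ.app V) ≫ T.adj.counit.app V

/-- `baseHomOver` is natural in `V`. [cite: Mochizuki2012, I Ex 3.2 (iv)(v) pp.71-72] -/
theorem proj_map_comp_baseHomOver {V V' : T.Ddash} (f : V ⟶ V') :
    T.proj.map (G.map f) ≫ baseHomOver G τ V' = baseHomOver G τ V ≫ f := by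
  simp only [baseHomOver]
  rw [← Category.assoc, ← Functor.map_comp, τ.naturality, Functor.map_comp, Category.assoc,
    Adjunction.counit_naturality, Category.assoc]

/-- **The field transport `Ω^V → Ω^{aug(G V)}`** along `baseHomOver` (an inclusion of subfields of `Ω = K̄_v`; for
`G = incl` and for `G = Ÿ × −` the two open subgroups coincide, `aug(aug⁻¹V) = V = aug(Π_Ÿ ∩ aug⁻¹ V)`, but we never use
this). [cite: Mochizuki2012, I Ex 3.2 (iv)(v) pp.71-72] -/
def fieldTransport (V : T.Ddash) : (d.fieldFunctor.obj V).K →+* (d.fieldFunctor.obj (T.proj.obj (G.obj V))).K :=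
  (d.fieldFunctor.map (baseHomOver G τ V)).alg

/-- The field transport is valuative. [cite: MochizukiFrdII2008, Ex 1.1 (i) p.7] -/
theorem fieldTransport_isValHom (V : T.Ddash) : PadicFrd.IsValHom (fieldTransport G τ V) :=
  (d.fieldFunctor.map (baseHomOver G τ V)).isValHom

/-- Naturality of the field transports. [cite: MochizukiFrdII2008, Ex 1.1 (i) p.7] -/
theorem fieldTransport_comp {V V' : T.Ddash} (f : V ⟶ V') :
    (fieldTransport G τ V).comp (d.fieldFunctor.map f).alg =
      (d.fieldFunctor.map (T.proj.map (G.map f))).alg.comp (fieldTransport G τ V') := by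
  rw [fieldTransport, fieldTransport, ← PadicFrd.PadicFld.comp_alg, ← PadicFrd.PadicFld.comp_alg, ← Functor.map_comp,
    ← Functor.map_comp, proj_map_comp_baseHomOver]

/-- The field transport carries the image of `q̲` in `Ω^V` to its image in `Ω^{aug(G V)}` (`K_v ↪ Ω^U` is a constant
section). [cite: MochizukiFrdII2008, Ex 1.1 (ii) p.8] -/
theorem intNonzeroMapOfHom_fieldTransport_img (qroot : intNonzero d.k) (V : T.Ddash) :
    PadicFrd.intNonzeroMapOfHom (fieldTransport G τ V) (fieldTransport_isValHom G τ V) (d.relEmb.img qroot V) =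
      d.relEmb.img qroot (T.proj.obj (G.obj V)) :=
  Subtype.ext (by
    change fieldTransport G τ V (d.relEmb.emb V qroot) = d.relEmb.emb (T.proj.obj (G.obj V)) qroot
    rw [fieldTransport, ← RingHom.comp_apply, d.relEmb.comp])

/-! ## The components of the morphism of model data `(Φ_{𝒞⊢}, B_{𝒞⊢}) → (Φ, B)|_G` -/

/-- The generator `ord(q̲_V) ⊗ 1` of `Φ_{𝒞⊢_v}(V) = ℕ·log_Φ(q̲_v)` is non-torsion (`Ω^V` is a `p_v`-adic local field).
[cite: MochizukiFrdII2008, Ex 1.1 (ii) p.8] -/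
theorem gen_pow_injective {qroot : intNonzero d.k} (hq : ¬ IsUnit qroot) (V : T.Ddash) :
    Injective fun n : ℕ => PadicFrd.Monogenic.gen d.fieldFunctor (d.relEmb.img qroot) V ^ n :=
  PadicFrd.Monogenic.gen_pow_injective d.fieldFunctor (d.relEmb.isConstantSection hq) (d.fieldFunctor_isPadicLocal V)

/-- **`log_Φ(q̲_v)|_A`**: the divisor of the constant `q̲_v` at the object `A` of `𝒟_v̲`, read in `Φ(A)` — the image of
the generator of `Φ_{𝒞⊢_v}`. [cite: Mochizuki2012, I Ex 3.2 (iv) p.71] -/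
def CarrierSpec.constDivQ (hC : CarrierSpec d T C) (qroot : intNonzero d.k) (A : T.Dv) : C.Φ.carrier (op A) :=
  hC.constDiv A (Associates.mk (d.relEmb.img qroot (T.proj.obj A)))

/-- `log_Φ(q̲_v)|_{A'}` pulls back to `log_Φ(q̲_v)|_A` ("a constant section"). [cite: Mochizuki2012, I Ex 3.2 (iv) p.71] -/
theorem CarrierSpec.pull_constDivQ (hC : CarrierSpec d T C) (qroot : intNonzero d.k) {A A' : T.Dv} (g : A ⟶ A') :
    C.Φ.pull g.op (hC.constDivQ qroot A') = hC.constDivQ qroot A := by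
  rw [CarrierSpec.constDivQ, CarrierSpec.pull_constDiv, PadicFrd.ordIntMapOfHom_mk, CarrierSpec.constDivQ]
  congr 2
  exact Subtype.ext (by
    change (d.fieldFunctor.map (T.proj.map g)).alg (d.relEmb.emb _ qroot) = d.relEmb.emb _ qroot
    rw [← RingHom.comp_apply, d.relEmb.comp])

/-- **`η_V : Φ_{𝒞⊢_v}(V) → Φ(G V)`, `n·log_Φ(q̲_v) ↦ n·log_Φ(q̲_v)|_{G V}`** (the Φ-component of the morphism of model data).
[cite: Mochizuki2012, I Ex 3.2 (iv) p.71] -/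
def constη (hC : CarrierSpec d T C) {qroot : intNonzero d.k} (hq : ¬ IsUnit qroot) (V : T.Ddashᵒᵖ) :
    ↥(Submonoid.powers (PadicFrd.Monogenic.gen d.fieldFunctor (d.relEmb.img qroot) V.unop)) →* C.Φ.carrier (op (G.obj V.unop)) :=
  powersLift (gen_pow_injective hq V.unop) (hC.constDivQ qroot (G.obj V.unop))

/-- `η_V (n·log q̲) = (log_Φ(q̲)|_{G V})^n`. [cite: Mochizuki2012, I Ex 3.2 (iv) p.71] -/
theorem constη_pow (hC : CarrierSpec d T C) {qroot : intNonzero d.k} (hq : ¬ IsUnit qroot) (V : T.Ddashᵒᵖ) (n : ℕ) :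
    constη G hC hq V ⟨_, n, rfl⟩ = hC.constDivQ qroot (G.obj V.unop) ^ n :=
  powersLift_pow _ _ n

/-- `η` is natural. [cite: Mochizuki2012, I Ex 3.2 (iv) p.71] -/
theorem constη_natural (hC : CarrierSpec d T C) {qroot : intNonzero d.k} (hq : ¬ IsUnit qroot) {V V' : T.Ddashᵒᵖ} (g : V ⟶ V')
    (x : ↥(Submonoid.powers (PadicFrd.Monogenic.gen d.fieldFunctor (d.relEmb.img qroot) V.unop))) :
    constη G hC hq V' (PadicFrd.Monogenic.ΦMap d.fieldFunctor (d.relEmb.isConstantSection hq) g x) =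
      C.Φ.pull (G.map g.unop).op (constη G hC hq V x) := by
  obtain ⟨_, n, rfl⟩ := x
  have h1 : PadicFrd.Monogenic.ΦMap d.fieldFunctor (d.relEmb.isConstantSection hq) g ⟨_, n, rfl⟩ =
      ⟨PadicFrd.Monogenic.gen d.fieldFunctor (d.relEmb.img qroot) V'.unop ^ n, n, rfl⟩ :=
    Subtype.ext (by rw [PadicFrd.Monogenic.coe_ΦMap, map_pow, PadicFrd.Monogenic.phi0Map_gen _ (d.relEmb.isConstantSection hq)])
  rw [h1, constη_pow, constη_pow, map_pow, hC.pull_constDivQ]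

/-- The exponent read `Φ_{𝒞⊢_v}(V) = ℕ·log q̲ → ord(𝒪^▷_{Ω^V})`, `n·log q̲ ↦ ord(q̲_V)^n` (de-realification of the monogenic
monoid). [cite: MochizukiFrdII2008, Ex 1.1 (ii) p.8] -/
def ordOfPowers {qroot : intNonzero d.k} (hq : ¬ IsUnit qroot) (V : T.Ddash) :
    ↥(Submonoid.powers (PadicFrd.Monogenic.gen d.fieldFunctor (d.relEmb.img qroot) V)) →* PadicFrd.OrdInt (d.fieldFunctor.obj V).K :=
  powersLift (gen_pow_injective hq V) (Associates.mk (d.relEmb.img qroot V))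

/-- Its value on `n·log q̲`. [cite: MochizukiFrdII2008, Ex 1.1 (ii) p.8] -/
theorem ordOfPowers_pow {qroot : intNonzero d.k} (hq : ¬ IsUnit qroot) (V : T.Ddash) (n : ℕ) :
    ordOfPowers hq V ⟨_, n, rfl⟩ = Associates.mk (d.relEmb.img qroot V) ^ n :=
  powersLift_pow _ _ n

/-- Realifying the exponent read gives back the inclusion `ℕ·log q̲ ⊆ Φ₀(V)`. [cite: MochizukiFrdII2008, Ex 1.1 (ii) p.8] -/
theorem of_comp_ordOfPowers {qroot : intNonzero d.k} (hq : ¬ IsUnit qroot) (V : T.Ddash) :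
    (Realification.of _).comp (ordOfPowers hq V) = (Submonoid.powers _).subtype :=
  powers_hom_ext fun n => by
    rw [MonoidHom.comp_apply, ordOfPowers_pow, map_pow, Submonoid.subtype_apply]
    rfl

/-- **Decoding `B_{𝒞⊢_v}(V)`**: for `(x, γ) ∈ B_{𝒞⊢_v}(V) = K^× ×_{Φ₀^gp} (ℕ·log q̲)^gp` the valuation class of `x` IS the
exponent of `γ` times `ord(q̲_V)` (`ord(𝒪^▷) → Φ₀` is injective on groupifications for a `p`-adic local field).
[cite: MochizukiFrdII2008, Ex 1.1 (ii) p.8] -/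
theorem divUnits_eq_of_mem_BSub {qroot : intNonzero d.k} (hq : ¬ IsUnit qroot) (V : T.Ddashᵒᵖ)
    (b : ↥(PadicFrd.Monogenic.BSub d.fieldFunctor (d.relEmb.isConstantSection hq) V)) :
    PadicFrd.divUnits (d.fieldFunctor.obj V.unop).K b.1.1 = MonGp.map (ordOfPowers hq V.unop) b.1.2 := by
  obtain ⟨inst, hfin, hc⟩ := (d.fieldFunctor_isPadicLocal V.unop).exists_finite
  haveI := isCancelMul_realification (PadicFrd.OrdInt (d.fieldFunctor.obj V.unop).K)
  have hinj : Injective (MonGp.map (Realification.of (PadicFrd.OrdInt (d.fieldFunctor.obj V.unop).K))) :=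
    MonGp.map_injective _ (Realification.of_injective (PadicFrd.isMonoprime_ordInt hc))
  apply hinj
  rw [← MonoidHom.comp_apply (MonGp.map _) (MonGp.map _), ← MonGp.map_comp, of_comp_ordOfPowers]
  exact (PadicFrd.Monogenic.mem_BSub_iff d.fieldFunctor (d.relEmb.isConstantSection hq) V b.1).mp b.2

/-- **`β_V : B_{𝒞⊢_v}(V) → B(G V)`, `(x, γ) ↦` the genuine constant rational function `x|_{Ω^{aug(G V)}}` at `G V`**
(GA-06's `constRatFn` via `T.proj`, after the field transport). [cite: Mochizuki2012, I Ex 3.2 (iv) p.71] -/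
def constβ (hC : CarrierSpec d T C) {qroot : intNonzero d.k} (hq : ¬ IsUnit qroot) (V : T.Ddashᵒᵖ) :
    ↥(PadicFrd.Monogenic.BSub d.fieldFunctor (d.relEmb.isConstantSection hq) V) →* ↥(C.ratFn (op (G.obj V.unop))) :=
  (constRatFn hC (G.obj V.unop)).comp
    ((Units.map (fieldTransport G τ V.unop : (d.fieldFunctor.obj V.unop).K →* (d.fieldFunctor.obj (T.proj.obj (G.obj V.unop))).K)).comp
      ((MonoidHom.fst _ _).comp (Submonoid.subtype _)))

/-- The value of `β_V`. [cite: Mochizuki2012, I Ex 3.2 (iv) p.71] -/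
theorem constβ_apply (hC : CarrierSpec d T C) {qroot : intNonzero d.k} (hq : ¬ IsUnit qroot) (V : T.Ddashᵒᵖ)
    (b : ↥(PadicFrd.Monogenic.BSub d.fieldFunctor (d.relEmb.isConstantSection hq) V)) :
    constβ G τ hC hq V b = constRatFn hC (G.obj V.unop)
      (Units.map (fieldTransport G τ V.unop : (d.fieldFunctor.obj V.unop).K →* _) b.1.1) := rfl

/-- `β` is natural (GA-06's `constRatFn` is natural along `T.proj`; the field transports are natural).
[cite: Mochizuki2012, I Ex 3.2 (iv) p.71] -/
theorem constβ_natural (hC : CarrierSpec d T C) {qroot : intNonzero d.k} (hq : ¬ IsUnit qroot) {V V' : T.Ddashᵒᵖ}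
    (g : V ⟶ V') (b : ↥(PadicFrd.Monogenic.BSub d.fieldFunctor (d.relEmb.isConstantSection hq) V)) :
    constβ G τ hC hq V' (PadicFrd.Monogenic.BMap d.fieldFunctor (d.relEmb.isConstantSection hq) g b) =
      C.ratFnPull (G.map g.unop).op (constβ G τ hC hq V b) := by
  change constRatFn hC (G.obj V'.unop) (Units.map (fieldTransport G τ V'.unop : (d.fieldFunctor.obj V'.unop).K →* _)
      (Units.map ((d.fieldFunctor.map g.unop).alg : (d.fieldFunctor.obj V.unop).K →* _) b.1.1)) =
    (C.ratFnFunctor.map (G.map g.unop).op).hom (constRatFn hC (G.obj V.unop)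
      (Units.map (fieldTransport G τ V.unop : (d.fieldFunctor.obj V.unop).K →* _) b.1.1))
  rw [← constRatFn_natural hC (G.map g.unop), ← MonoidHom.comp_apply (Units.map _) (Units.map _),
    ← Units.map_comp, ← MonoidHom.comp_apply (Units.map _) (Units.map _), ← Units.map_comp]
  congr 3
  exact congrArg RingHom.toMonoidHom (fieldTransport_comp G τ g.unop)

/-- **THE MORPHISM OF MODEL DATA `(Φ_{𝒞⊢_v}, B_{𝒞⊢_v}, Div) → (Φ, B, Div_B)|_G` OVER `G`** ([FrdI] Thm. 6.2 (i) shape,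
abc-iut-w5-d048's `ModelFrobenioid.DataHomOver`): `η = (n·log q̲ ↦ n·log_Φ(q̲)|_{G V})`, `β = (x ↦` the genuine
constant `x` at `G V)`; the compatibility with the divisor maps is the DECODING of `B_{𝒞⊢_v}` (`divUnits_eq_of_mem_BSub`)
followed by `Div_B(constant) = valuation` (GA-06's `divB_constRatFn`). [cite: Mochizuki2012, I Ex 3.2 (iv) p.71] -/
def constDataHomOver (hC : CarrierSpec d T C) {qroot : intNonzero d.k} (hq : ¬ IsUnit qroot) :
    ModelFrobenioid.DataHomOver G (d.dashDatum hq).divB C.divBNatTrans where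
  η :=
    { app := fun V => CommMonCat.ofHom (constη G hC hq V)
      naturality := fun {V V'} g => by
        apply CommMonCat.hom_ext
        refine MonoidHom.ext fun x => ?_
        exact constη_natural G hC hq g x }
  β :=
    { app := fun V => CommMonCat.ofHom (constβ G τ hC hq V)
      naturality := fun {V V'} g => by
        apply CommMonCat.hom_ext
        refine MonoidHom.ext fun b => ?_
        exact constβ_natural G τ hC hq g b }
  comm V b := by
    change MonGp.map (constη G hC hq V) b.1.2 =
      gpMap (hC.ofLattice (G.obj V.unop)) (gpMap (hC.constDivIncl (op (G.obj V.unop)))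
        (PadicFrd.divUnits _ (Units.map (fieldTransport G τ V.unop : (d.fieldFunctor.obj V.unop).K →* _) b.1.1)))
    rw [PadicFrd.divUnits_map _ (fieldTransport_isValHom G τ V.unop), divUnits_eq_of_mem_BSub hq V b]
    have key : MonGp.map (constη G hC hq V) =
        (gpMap (hC.ofLattice (G.obj V.unop))).comp ((gpMap (hC.constDivIncl (op (G.obj V.unop)))).comp
          ((PadicFrd.gpMapOfHom (fieldTransport G τ V.unop) (fieldTransport_isValHom G τ V.unop)).comp
            (MonGp.map (ordOfPowers hq V.unop)))) :=
      MonGp.hom_ext fun a => by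
        obtain ⟨_, n, rfl⟩ := a
        simp only [MonoidHom.comp_apply, MonGp.map_of, constη_pow, ordOfPowers_pow, PadicFrd.gpMapOfHom_of, gpMap_of,
          map_pow, PadicFrd.ordIntMapOfHom_mk, intNonzeroMapOfHom_fieldTransport_img]
        rfl
    exact DFunLike.congr_fun key _

/-- **THE CONSTANTS FUNCTOR `𝒞⊢_v → ℱ̲_v` OVER `G`** (the functor of model Frobenioids induced by `constDataHomOver`,
[FrdI] Thm. 5.2 (i)/6.2 (i)): `(V, n·log q̲) ↦ (G V, n·log_Φ(q̲)|_{G V})`, `(deg, f, Div, x) ↦ (deg, G f, η Div, x|_{G V})`.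
[cite: Mochizuki2012, I Ex 3.2 (iv) p.71] -/
def constFunctorOver (hC : CarrierSpec d T C) {qroot : intNonzero d.k} (hq : ¬ IsUnit qroot) :
    d.Cdash hq ⥤ C.category :=
  (constDataHomOver G τ hC hq).functor

/-- The constants functor lies over `G` ON THE NOSE: `constFunctorOver ⋙ (ℱ̲_v → 𝒟_v̲) = (𝒞⊢_v → 𝒟⊢_v̲) ⋙ G`.
[cite: Mochizuki2012, I Ex 3.2 (iv) p.71] -/
theorem constFunctorOver_comp_base (hC : CarrierSpec d T C) {qroot : intNonzero d.k} (hq : ¬ IsUnit qroot) :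
    constFunctorOver G τ hC hq ⋙ C.baseFunctorOfCategory = d.CdashBase hq ⋙ G :=
  (constDataHomOver G τ hC hq).functor_comp_baseFunctor

/-- `η_V` is injective: `n·log_Φ(q̲)|_{G V}` determines `n` (the divisor of the non-unit constant `q̲` is non-torsion:
`constDiv` injective and `ord(q̲) ⊗ 1` non-torsion at `aug(G V)`). [cite: Mochizuki2012, I Ex 3.2 (iv) p.71] -/
theorem constη_injective (hC : CarrierSpec d T C) {qroot : intNonzero d.k} (hq : ¬ IsUnit qroot) (V : T.Ddashᵒᵖ) :
    Injective (constη G hC hq V) := by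
  rintro ⟨_, n, rfl⟩ ⟨_, m, rfl⟩ h
  rw [constη_pow, constη_pow, CarrierSpec.constDivQ, ← map_pow, ← map_pow] at h
  have h2 := hC.constDiv_injective _ h
  have h3 := congrArg (Realification.of _) h2
  rw [map_pow, map_pow] at h3
  have h4 : n = m := gen_pow_injective hq (T.proj.obj (G.obj V.unop)) h3
  subst h4
  rfl

/-- `β_V` is injective (`B_{𝒞⊢_v} → K^×` injective as the datum is cartesian, the field transport injective, GA-06's
`constRatFn_injective`). [cite: Mochizuki2012, I Ex 3.2 (iv) p.71] -/
theorem constβ_injective (hC : CarrierSpec d T C) {qroot : intNonzero d.k} (hq : ¬ IsUnit qroot) (V : T.Ddashᵒᵖ) :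
    Injective (constβ G τ hC hq V) := by
  intro b b' h
  rw [constβ_apply, constβ_apply] at h
  have h1 := Units.ext_iff.mp (constRatFn_injective hC _ h)
  have h2 : b.1.1 = b'.1.1 := Units.ext ((fieldTransport G τ V.unop).injective h1)
  have hb := (PadicFrd.Monogenic.mem_BSub_iff d.fieldFunctor (d.relEmb.isConstantSection hq) V b.1).mp b.2
  have hb' := (PadicFrd.Monogenic.mem_BSub_iff d.fieldFunctor (d.relEmb.isConstantSection hq) V b'.1).mp b'.2
  have hγ : b.1.2 = b'.1.2 := by
    haveI := isCancelMul_realification (PadicFrd.OrdInt (d.fieldFunctor.obj V.unop).K)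
    apply MonGp.map_injective (Submonoid.subtype _) Subtype.val_injective
    change ((Functor.whiskerRight (PadicFrd.Monogenic.ιc d.fieldFunctor (d.relEmb.isConstantSection hq)) MonGp.functor).app V).hom
        b.1.2 = ((Functor.whiskerRight (PadicFrd.Monogenic.ιc d.fieldFunctor (d.relEmb.isConstantSection hq)) MonGp.functor).app V).hom
        b'.1.2
    rw [← hb, ← hb', h2]
  exact Subtype.ext (Prod.ext h2 hγ)

/-- **The constants functor over a faithful `G` is faithful** ([FrdI] Cor. 5.4 criterion, abc-iut-w5-d137's
`DataHomOver.functor_faithful`: `G` faithful, `η`, `β` injective) — NON-VACUOUSLY over all of `𝒟⊢_v̲`.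
[cite: MochizukiFrdI2008, Cor. 5.4 p.104] -/
theorem constFunctorOver_faithful (hC : CarrierSpec d T C) {qroot : intNonzero d.k} (hq : ¬ IsUnit qroot) [G.Faithful] :
    (constFunctorOver G τ hC hq).Faithful :=
  (constDataHomOver G τ hC hq).functor_faithful (fun V => constη_injective G hC hq (op V))
    (fun V => constβ_injective G τ hC hq (op V))

end OverG

end ArithThetaTower

end Literature.AnabelianGeometry.EtaleTheta

end
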